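import Summits.BirchSwinnertonDyer.BirchSwinnertonDyer.Theorems.ByReductionTypeAtTwoAdditiveKatoTransportPrintExactAnyImageDoors
import Summits.BirchSwinnertonDyer.BirchSwinnertonDyer.Theorems.ByReductionTypeAtTwoOrdIsogenyDualMaps
import Literature.NumberTheory.EllipticCurves.IwasawaSelmerQuadraticLayerDualProofs
import HarnessLib

/-!
# Route ByReductionTypeAtTwo, crux C4″ `AdditivePotMultOverKAtTwo` (stmt-BirchSwinnertonDyer-22618; parent
# `AdditiveRankZeroAtTwo` 19098) — R16, part 4: R14 (b) «LATTICE-FREE» IN THE KERNEL at the level of the dual Selmer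
# group — `ℓ_𝔮(X(W/K_∞)) = ℓ_𝔮(X(W'/K_∞))` at every prime `𝔮 ∌ p` of `Λ` for `K`-isogenous `W ∼ W'` (any number field,
# any `p`, any `ℤ_p`-extension, any key `γ`) — and the MEMBER doors: Kato's divisibility `ℓ_𝔮(X(W'/ℚ_∞)) ≤ ℓ_𝔮(Λ/(L̃))`
# at every height-one `𝔮 ∌ 2` for EVERY curve `W'` isogenous over `ℚ` to a split-twist additive `W` (in particular
# Kato's member `W_K`, `T₂W_K ≅ V_{ℤ₂}(f)(1)`), from the ONE image-free input (theorems only)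

Cell `bsd-2adic`, seat `bsd-2adic-k4-w3` GEN 4. GEN 0's R14 (b) («the missing inequality at `𝔮₀` is LATTICE-FREE: for
`ℚ`-isogenous lattices the maps on Kato's modules have kernel and cokernel killed by a power of `2`, so the lengths at
every height-one `𝔮 ∌ 2` agree — Conj. 12.10's inequality at the member's lattice IS the same inequality at `T₂W`»)
was a READING. At the level of the dual Selmer group it is a three-line kernel theorem from two tree results:
the PSEUDO-ISOGENY PAIR `Sel(φ)^∨ : X(W') ⇄ X(W) : Sel(φ̂)^∨` of a `K`-isogeny — `Λ`-linear with both composites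
`deg φ` (`IsogenyMuShift.exists_pseudoIsogenyPair`, seat ord-3) — and «a linear map with kernel and cokernel killed by
`n ∉ 𝔮` preserves `ℓ_𝔮`» (`Module.lengthAt_eq_of_smul_ker_of_smul_range`, seat t42 GEN 23); `C(deg φ) ∉ 𝔮` because
`deg φ = u·p^k` in `ℤ_p` and `𝔮 ∌ p`.

* §1 `C_natCast_not_mem_of_C_p_not_mem` (a non-zero constant lies in no prime `𝔮 ∌ p`),
  **`lengthAt_selmerDual_eq_of_isogeny`** / `…_of_isIsogenous` (generic: any `K`, `p`, `κ`, `γ`).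
* §2 the four MEMBER doors of the split-twist additive blocks at `p = 2` — blocks `(−1)`/`(−2)`, keys `γ⁻¹`/`γ` — for
  every `W' ∼_ℚ W`: `ℓ_𝔮(X(W'/ℚ_∞)) ≤ ℓ_𝔮(Λ/(L̃))` at every height-one `𝔮 ∌ 2`, the exceptional prime of (12.5.1)
  included, from `Kato2004.thm12_4`, the ONE image-free input `KatoOddBranchInputsAtTwoNegOneSplitTwistPrintExactAnyImage`
  (the `(−2)` doors through R15, `AddKatoTwoGammaTwist.katoOddBranchInputsNegTwoPrintExactAnyImage_of_negOne` — NOT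
  imported here to keep the cone small: the `(−2)` doors take the `(−2)` image-free constant, which that theorem
  supplies), the symmetry `ι(char X(W)) = char X(W)` (T20 (a)) and an integral multiple of the relevant minus branch —
  the doors of `…PrintExactAnyImageDoors.lean` composed with §1.

USE (R14 (c), reducible blocks). Kato's member package (`Kato2004.MemberHullInputs`, readings R1–R13/R12♯) lives at the
member `W_K ∼ W`; its one twist-sensitive field `divisibility_offP` at `𝔮₀` is fed, at the reading level, by Conj.
12.10's inequality at `𝔮₀`, itself read off Kato's divisibility in `X`-currency by §17.13's exceptional identity
(kernel `Kato2004.lengthAt_H2_le_of_transport_exceptional`). §2 delivers that `X`-currency divisibility AT THE MEMBER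
(any `W' ∼ W`, any image of `ρ̄`) in the kernel; the passage `X`-currency ↦ `𝐇²`-currency inside the member's own
§17.13 skeleton remains part of the member READING (the hull structure carries no Poitou–Tate skeleton).

HONEST FRAMING (D-0036 / D-0054): theorems only — no definition, no named fact, no instance, no `sorry`;
route-independent (no `Theses` import); CONDITIONAL on the named typed input and `Kato2004.thm12_4` exactly as the doors
they extend; types-the-object-of (one sentence of R14 (b) ↦ kernel); closes none; nothing booked; BSD is not proved by
any of this. PARTITION: X5@2 additive potentially-multiplicative block, the four split-twist sub-blocks × `p = 2`
(§2); §1 is prime- and field-generic.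

References: [Kato2004Asterisque] §8.3 (p. 181), Thm. 12.4 (2) (p. 221), Thm. 12.5 (3) with (12.5.1) (p. 222), Conj.
12.10 (p. 224), §17.13 (pp. 279–280); [GreenbergVatsal2000] §2 p. 28 (isogeny and `Λ`-modules); [GreenbergLNM1716] §1
(p. 60), Thm. 1.14 (p. 68); [BourbakiAC5to7] VII §4.4; [Washington1997] §13.2; [MazurTateTeitelbaum1986Invent] §I.17;
memo `run/shared/lean/pub/bsd-2adic/k4w3/gen4/VERDICT-22618-k4w3-GEN4.md`.
-/

set_option autoImplicit false
-- the summit's namespace `Summit.BirchSwinnertonDyer.BirchSwinnertonDyer` (Sub = Summit) trips `dupNamespace`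
set_option linter.dupNamespace false

noncomputable section

open scoped Classical MatrixGroups ModularForm

open Field CongruenceSubgroup WeierstrassCurve Literature.NumberTheory.EllipticCurves
  Literature.NumberTheory.EllipticCurves.ModularForms Literature.NumberTheory.EllipticCurves.IwasawaAlgebra
  Literature.NumberTheory.EllipticCurves.Module

namespace Summit.BirchSwinnertonDyer.BirchSwinnertonDyer.Theorems.AddKatoTwo

universe u

/-! ## §1 Dual Selmer lengths away from `p` are isogeny invariants -/

section Isogeny

variable {K : Type u} [Field K] [NumberField K] {W W' : WeierstrassCurve K} [W.IsElliptic] [W'.IsElliptic]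
  {p : ℕ} [Fact p.Prime] {κ : ZpExtension K p} {γ : absoluteGaloisGroup K}

omit [W.IsElliptic] [W'.IsElliptic] in
/-- A non-zero natural constant `C n` lies in no prime `𝔮 ∌ C p` of `Λ = ℤ_p⟦T⟧`: `n = u·p^k` in `ℤ_p` with `u` a unit.
[cite: Washington1997, §13.2] -/
theorem C_natCast_not_mem_of_C_p_not_mem {n : ℕ} (hn : n ≠ 0) (𝔮 : PrimeSpectrum (IwasawaAlgebra p))
    (hp𝔮 : PowerSeries.C (p : ℤ_[p]) ∉ 𝔮.asIdeal) : PowerSeries.C (n : ℤ_[p]) ∉ 𝔮.asIdeal := by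
  have hx : (n : ℤ_[p]) ≠ 0 := by exact_mod_cast hn
  intro hx𝔮
  rw [PadicInt.unitCoeff_spec hx, map_mul, map_pow] at hx𝔮
  rcases 𝔮.isPrime.mem_or_mem hx𝔮 with h | h
  · exact 𝔮.isPrime.ne_top (Ideal.eq_top_of_isUnit_mem _ h ((Units.isUnit _).map _))
  · exact hp𝔮 (𝔮.isPrime.mem_of_pow_mem _ h)

/-- **`ℓ_𝔮(X(W/K_∞)) = ℓ_𝔮(X(W'/K_∞))` at every prime `𝔮 ∌ p` of `Λ` along a `K`-isogeny `φ : W → W'`** (any number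
field `K`, prime `p`, `ℤ_p`-extension `κ`, key `γ`; `D`, `D'` the dual Selmer data of `W`, `W'`). Proof: the pseudo-isogeny
pair `F = Sel(φ)^∨ : D'.X → D.X`, `G = Sel(φ̂)^∨ : D.X → D'.X`, `Λ`-linear with `G ∘ F = F ∘ G = C(deg φ)`
(`IsogenyMuShift.exists_pseudoIsogenyPair`), so `G` has kernel and cokernel killed by `C(deg φ) ∉ 𝔮`
(`C_natCast_not_mem_of_C_p_not_mem`) and `Module.lengthAt_eq_of_smul_ker_of_smul_range` applies. This is R14 (b)
(«lattice-free») of `…AdditiveReducibleSplitTwistKatoMemberDefs.lean` at the level of the dual Selmer group.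
[cite: GreenbergVatsal2000, §2 (p. 28)] [cite: BourbakiAC5to7, VII §4.4] [cite: GreenbergLNM1716, §1 (p. 60)] -/
theorem lengthAt_selmerDual_eq_of_isogeny (φ : Isogeny W W') (D : W.SelmerDualData κ γ)
    (D' : W'.SelmerDualData κ γ) (𝔮 : PrimeSpectrum (IwasawaAlgebra p))
    (hp𝔮 : PowerSeries.C (p : ℤ_[p]) ∉ 𝔮.asIdeal) :
    lengthAt (IwasawaAlgebra p) D.X 𝔮 = lengthAt (IwasawaAlgebra p) D'.X 𝔮 := by
  obtain ⟨F, G, n, hn0, hGF, hFG⟩ := IsogenyMuShift.exists_pseudoIsogenyPair φ D D'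
  refine Module.lengthAt_eq_of_smul_ker_of_smul_range G 𝔮 (C_natCast_not_mem_of_C_p_not_mem hn0 𝔮 hp𝔮)
    (fun x hx ↦ ?_) (fun y ↦ ⟨F y, hGF y⟩)
  rw [← hFG x, hx, map_zero]

/-- `IsIsogenous` form of `lengthAt_selmerDual_eq_of_isogeny`: dual Selmer lengths at primes `𝔮 ∌ p` are constant on a
`K`-isogeny class. [cite: GreenbergVatsal2000, §2 (p. 28)] [cite: BourbakiAC5to7, VII §4.4] -/
theorem lengthAt_selmerDual_eq_of_isIsogenous (hiso : IsIsogenous W W') (D : W.SelmerDualData κ γ)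
    (D' : W'.SelmerDualData κ γ) (𝔮 : PrimeSpectrum (IwasawaAlgebra p))
    (hp𝔮 : PowerSeries.C (p : ℤ_[p]) ∉ 𝔮.asIdeal) :
    lengthAt (IwasawaAlgebra p) D.X 𝔮 = lengthAt (IwasawaAlgebra p) D'.X 𝔮 := by
  obtain ⟨φ⟩ := hiso
  exact lengthAt_selmerDual_eq_of_isogeny φ D D' 𝔮 hp𝔮

end Isogeny

/-! ## §2 The MEMBER doors of the split-twist additive blocks at `p = 2` (any `W' ∼_ℚ W`, any image of `ρ̄`) -/

/-- **Member door, (−1)-block, key `γ⁻¹`.** For `W` globally minimal, additive with `W^{(−1)}` split multiplicative at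
`2`, `f` the newform of `W^{(−1)}`, `(κ, γ)` cyclotomic, `D'` a key-`γ⁻¹` dual Selmer datum of `W` with `D'.X` finitely
generated and `ι(char D'.X) = char D'.X`, `L̃ = 2^m L⁻ ≠ 0`, and ANY curve `W₁` isogenous to `W` over `ℚ` (e.g. Kato's
member) with key-`γ⁻¹` datum `D₁'`: `ℓ_𝔮(D₁'.X) ≤ ℓ_𝔮(Λ/(L̃))` at every height-one `𝔮 ∌ 2`, from `Kato2004.thm12_4`
and the ONE image-free input — `lengthAt_selmerDualContra_le_of_oddBranchInputsPrintExactAnyImage_fe` + §1.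
[cite: Kato2004Asterisque, §8.3 (p. 181), Thm. 12.4 (2) (p. 221), Thm. 12.5 (3) and (12.5.1) (p. 222), §17.13 (pp. 279–280)]
[cite: GreenbergVatsal2000, §2 (p. 28)] [cite: MazurTateTeitelbaum1986Invent, §I.17] -/
theorem lengthAt_selmerDualContra_le_of_oddBranchInputsPrintExactAnyImage_fe_of_isIsogenous
    (h12 : Kato2004.thm12_4) (hPE : KatoOddBranchInputsAtTwoNegOneSplitTwistPrintExactAnyImage)
    (W : WeierstrassCurve ℚ) [W.IsElliptic] [W.IsGloballyMinimal] [ContinuousSMul ℤ_[2] (W.tateModule 2)]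
    {N : ℕ} [NeZero N] (f : CuspForm (Gamma0 N) 2) (κ : ZpExtension ℚ 2) (γ : absoluteGaloisGroup ℚ)
    (hsp : (W.quadraticTwist (-1)).HasSplitMultiplicativeReductionAtPrime 2)
    (hκ : κ.IsCyclotomic) (hγ : κ.IsTopGenerator γ)
    (hγ' : IsCyclotomicVariable 2 γ) (hf : IsNewformOf (W.quadraticTwist (-1)) f)
    (I : Kato2004.IwasawaH1Data W 2 κ γ) (D' : W.SelmerDualData κ γ⁻¹) [Module.Finite (IwasawaAlgebra 2) D'.X]
    (hXι : (charIdeal (IwasawaAlgebra 2) D'.X).map (invol 2).toRingHom = charIdeal (IwasawaAlgebra 2) D'.X)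
    (Lt : IwasawaAlgebra 2) (m : ℕ)
    (hLt : iwasawaToPowerSeries 2 Lt =
      PowerSeries.C ((2 : ℚ_[2]) ^ m) * padicLFunctionMinusBranchMult f (1 : ℚ_[2]) 1)
    (hLt0 : Lt ≠ 0)
    (W₁ : WeierstrassCurve ℚ) [W₁.IsElliptic] (hiso : IsIsogenous W W₁) (D₁' : W₁.SelmerDualData κ γ⁻¹)
    (𝔮 : PrimeSpectrum (IwasawaAlgebra 2)) (h𝔮 : 𝔮.asIdeal.height = 1)
    (hp𝔮 : PowerSeries.C (2 : ℤ_[2]) ∉ 𝔮.asIdeal) :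
    lengthAt (IwasawaAlgebra 2) D₁'.X 𝔮 ≤
      lengthAt (IwasawaAlgebra 2) (IwasawaAlgebra 2 ⧸ Ideal.span {Lt}) 𝔮 := by
  have hp𝔮' : PowerSeries.C ((2 : ℕ) : ℤ_[2]) ∉ 𝔮.asIdeal := by exact_mod_cast hp𝔮
  rw [← lengthAt_selmerDual_eq_of_isIsogenous hiso D' D₁' 𝔮 hp𝔮']
  exact lengthAt_selmerDualContra_le_of_oddBranchInputsPrintExactAnyImage_fe h12 hPE W f κ γ hsp hκ hγ hγ' hf I D' hXι
    Lt m hLt hLt0 𝔮 h𝔮 hp𝔮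

/-- **Member door, (−1)-block, key `γ`** (the tree's dual Selmer datum): as
`lengthAt_selmerDualContra_le_of_oddBranchInputsPrintExactAnyImage_fe_of_isIsogenous` with `D : W.SelmerDualData κ γ`
and `D₁ : W₁.SelmerDualData κ γ` — `lengthAt_selmerDual_le_of_oddBranchInputsPrintExactAnyImage_fe` + §1.
[cite: Kato2004Asterisque, §8.3 (p. 181), Thm. 12.4 (2) (p. 221), Thm. 12.5 (3) and (12.5.1) (p. 222), §17.3 (p. 273), §17.13 (pp. 279–280)]
[cite: GreenbergVatsal2000, §2 (p. 28)] [cite: Greenberg1989, pp. 101–102 (S^ι)] [cite: MazurTateTeitelbaum1986Invent, §I.17] -/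
theorem lengthAt_selmerDual_le_of_oddBranchInputsPrintExactAnyImage_fe_of_isIsogenous
    (h12 : Kato2004.thm12_4) (hPE : KatoOddBranchInputsAtTwoNegOneSplitTwistPrintExactAnyImage)
    (W : WeierstrassCurve ℚ) [W.IsElliptic] [W.IsGloballyMinimal] [ContinuousSMul ℤ_[2] (W.tateModule 2)]
    {N : ℕ} [NeZero N] (f : CuspForm (Gamma0 N) 2) (κ : ZpExtension ℚ 2) (γ : absoluteGaloisGroup ℚ)
    (hsp : (W.quadraticTwist (-1)).HasSplitMultiplicativeReductionAtPrime 2)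
    (hκ : κ.IsCyclotomic) (hγ : κ.IsTopGenerator γ)
    (hγ' : IsCyclotomicVariable 2 γ) (hf : IsNewformOf (W.quadraticTwist (-1)) f)
    (I : Kato2004.IwasawaH1Data W 2 κ γ) (D : W.SelmerDualData κ γ) [Module.Finite (IwasawaAlgebra 2) D.X]
    (hXι : (charIdeal (IwasawaAlgebra 2) D.X).map (invol 2).toRingHom = charIdeal (IwasawaAlgebra 2) D.X)
    (Lt : IwasawaAlgebra 2) (m : ℕ)
    (hLt : iwasawaToPowerSeries 2 Lt =
      PowerSeries.C ((2 : ℚ_[2]) ^ m) * padicLFunctionMinusBranchMult f (1 : ℚ_[2]) 1)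
    (hLt0 : Lt ≠ 0)
    (W₁ : WeierstrassCurve ℚ) [W₁.IsElliptic] (hiso : IsIsogenous W W₁) (D₁ : W₁.SelmerDualData κ γ)
    (𝔮 : PrimeSpectrum (IwasawaAlgebra 2)) (h𝔮 : 𝔮.asIdeal.height = 1)
    (hp𝔮 : PowerSeries.C (2 : ℤ_[2]) ∉ 𝔮.asIdeal) :
    lengthAt (IwasawaAlgebra 2) D₁.X 𝔮 ≤
      lengthAt (IwasawaAlgebra 2) (IwasawaAlgebra 2 ⧸ Ideal.span {Lt}) 𝔮 := by
  have hp𝔮' : PowerSeries.C ((2 : ℕ) : ℤ_[2]) ∉ 𝔮.asIdeal := by exact_mod_cast hp𝔮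
  rw [← lengthAt_selmerDual_eq_of_isIsogenous hiso D D₁ 𝔮 hp𝔮']
  exact lengthAt_selmerDual_le_of_oddBranchInputsPrintExactAnyImage_fe h12 hPE W f κ γ hsp hκ hγ hγ' hf I D hXι
    Lt m hLt hLt0 𝔮 h𝔮 hp𝔮

/-- **Member door, (−2)-block, key `γ⁻¹`**: for `W` globally minimal, additive with `W^{(−2)}` split multiplicative at
`2`, `f` the newform of `W^{(−2)}`, the image-free `(−2)` input (a THEOREM modulo the `(−1)` input by R15:
`AddKatoTwoGammaTwist.katoOddBranchInputsNegTwoPrintExactAnyImage_of_negOne`), `L̃ = 2^m L⁻₂ ≠ 0` a multiple of the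
`ω·χ₂`-branch, and ANY `W₁ ∼_ℚ W` with key-`γ⁻¹` datum `D₁'`: `ℓ_𝔮(D₁'.X) ≤ ℓ_𝔮(Λ/(L̃))` at every height-one
`𝔮 ∌ 2` — `lengthAt_selmerDualContra_le_of_oddBranchInputsNegTwoPrintExactAnyImage_fe` + §1.
[cite: Kato2004Asterisque, §8.3 (p. 181), Thm. 12.4 (2) (p. 221), Thm. 12.5 (3) and (12.5.1) (p. 222), §17.13 (pp. 279–280)]
[cite: GreenbergVatsal2000, §2 (p. 28)] [cite: MazurTateTeitelbaum1986Invent, §I.17] -/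
theorem lengthAt_selmerDualContra_le_of_oddBranchInputsNegTwoPrintExactAnyImage_fe_of_isIsogenous
    (h12 : Kato2004.thm12_4) (hPE : KatoOddBranchInputsAtTwoNegTwoSplitTwistPrintExactAnyImage)
    (W : WeierstrassCurve ℚ) [W.IsElliptic] [W.IsGloballyMinimal] [ContinuousSMul ℤ_[2] (W.tateModule 2)]
    {N : ℕ} [NeZero N] (f : CuspForm (Gamma0 N) 2) (κ : ZpExtension ℚ 2) (γ : absoluteGaloisGroup ℚ)
    (hsp : (W.quadraticTwist (-2)).HasSplitMultiplicativeReductionAtPrime 2)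
    (hκ : κ.IsCyclotomic) (hγ : κ.IsTopGenerator γ)
    (hγ' : IsCyclotomicVariable 2 γ) (hf : IsNewformOf (W.quadraticTwist (-2)) f)
    (I : Kato2004.IwasawaH1Data W 2 κ γ) (D' : W.SelmerDualData κ γ⁻¹) [Module.Finite (IwasawaAlgebra 2) D'.X]
    (hXι : (charIdeal (IwasawaAlgebra 2) D'.X).map (invol 2).toRingHom = charIdeal (IwasawaAlgebra 2) D'.X)
    (Lt : IwasawaAlgebra 2) (m : ℕ)
    (hLt : iwasawaToPowerSeries 2 Lt =
      PowerSeries.C ((2 : ℚ_[2]) ^ m) * padicLFunctionMinusBranchMultTwist f (1 : ℚ_[2]) 1 (-1))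
    (hLt0 : Lt ≠ 0)
    (W₁ : WeierstrassCurve ℚ) [W₁.IsElliptic] (hiso : IsIsogenous W W₁) (D₁' : W₁.SelmerDualData κ γ⁻¹)
    (𝔮 : PrimeSpectrum (IwasawaAlgebra 2)) (h𝔮 : 𝔮.asIdeal.height = 1)
    (hp𝔮 : PowerSeries.C (2 : ℤ_[2]) ∉ 𝔮.asIdeal) :
    lengthAt (IwasawaAlgebra 2) D₁'.X 𝔮 ≤
      lengthAt (IwasawaAlgebra 2) (IwasawaAlgebra 2 ⧸ Ideal.span {Lt}) 𝔮 := by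
  have hp𝔮' : PowerSeries.C ((2 : ℕ) : ℤ_[2]) ∉ 𝔮.asIdeal := by exact_mod_cast hp𝔮
  rw [← lengthAt_selmerDual_eq_of_isIsogenous hiso D' D₁' 𝔮 hp𝔮']
  exact lengthAt_selmerDualContra_le_of_oddBranchInputsNegTwoPrintExactAnyImage_fe h12 hPE W f κ γ hsp hκ hγ hγ' hf
    I D' hXι Lt m hLt hLt0 𝔮 h𝔮 hp𝔮

/-- **Member door, (−2)-block, key `γ`**: as the key-`γ⁻¹` door with `D : W.SelmerDualData κ γ`, `D₁ : W₁.SelmerDualData κ γ`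
— `lengthAt_selmerDual_le_of_oddBranchInputsNegTwoPrintExactAnyImage_fe` + §1.
[cite: Kato2004Asterisque, §8.3 (p. 181), Thm. 12.4 (2) (p. 221), Thm. 12.5 (3) and (12.5.1) (p. 222), §17.3 (p. 273), §17.13 (pp. 279–280)]
[cite: GreenbergVatsal2000, §2 (p. 28)] [cite: Greenberg1989, pp. 101–102 (S^ι)] [cite: MazurTateTeitelbaum1986Invent, §I.17] -/
theorem lengthAt_selmerDual_le_of_oddBranchInputsNegTwoPrintExactAnyImage_fe_of_isIsogenous
    (h12 : Kato2004.thm12_4) (hPE : KatoOddBranchInputsAtTwoNegTwoSplitTwistPrintExactAnyImage)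
    (W : WeierstrassCurve ℚ) [W.IsElliptic] [W.IsGloballyMinimal] [ContinuousSMul ℤ_[2] (W.tateModule 2)]
    {N : ℕ} [NeZero N] (f : CuspForm (Gamma0 N) 2) (κ : ZpExtension ℚ 2) (γ : absoluteGaloisGroup ℚ)
    (hsp : (W.quadraticTwist (-2)).HasSplitMultiplicativeReductionAtPrime 2)
    (hκ : κ.IsCyclotomic) (hγ : κ.IsTopGenerator γ)
    (hγ' : IsCyclotomicVariable 2 γ) (hf : IsNewformOf (W.quadraticTwist (-2)) f)
    (I : Kato2004.IwasawaH1Data W 2 κ γ) (D : W.SelmerDualData κ γ) [Module.Finite (IwasawaAlgebra 2) D.X]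
    (hXι : (charIdeal (IwasawaAlgebra 2) D.X).map (invol 2).toRingHom = charIdeal (IwasawaAlgebra 2) D.X)
    (Lt : IwasawaAlgebra 2) (m : ℕ)
    (hLt : iwasawaToPowerSeries 2 Lt =
      PowerSeries.C ((2 : ℚ_[2]) ^ m) * padicLFunctionMinusBranchMultTwist f (1 : ℚ_[2]) 1 (-1))
    (hLt0 : Lt ≠ 0)
    (W₁ : WeierstrassCurve ℚ) [W₁.IsElliptic] (hiso : IsIsogenous W W₁) (D₁ : W₁.SelmerDualData κ γ)
    (𝔮 : PrimeSpectrum (IwasawaAlgebra 2)) (h𝔮 : 𝔮.asIdeal.height = 1)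
    (hp𝔮 : PowerSeries.C (2 : ℤ_[2]) ∉ 𝔮.asIdeal) :
    lengthAt (IwasawaAlgebra 2) D₁.X 𝔮 ≤
      lengthAt (IwasawaAlgebra 2) (IwasawaAlgebra 2 ⧸ Ideal.span {Lt}) 𝔮 := by
  have hp𝔮' : PowerSeries.C ((2 : ℕ) : ℤ_[2]) ∉ 𝔮.asIdeal := by exact_mod_cast hp𝔮
  rw [← lengthAt_selmerDual_eq_of_isIsogenous hiso D D₁ 𝔮 hp𝔮']
  exact lengthAt_selmerDual_le_of_oddBranchInputsNegTwoPrintExactAnyImage_fe h12 hPE W f κ γ hsp hκ hγ hγ' hf I D hXι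
    Lt m hLt hLt0 𝔮 h𝔮 hp𝔮

end Summit.BirchSwinnertonDyer.BirchSwinnertonDyer.Theorems.AddKatoTwo

end
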